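import Literature.Computability.Cryptography.PeikertBDDIdealised
import Literature.Algebra.EuclideanLattices.RegevQuantumPart
import HarnessLib

/-!
# Regev 2009, Lemma 3.14 in machine form: the integer arithmetic of the sampler's classical stage

Topic `Computability/Cryptography` (family `pqc`), grouping namespace `Regev2009.SamplerArith`. The
quantum sampler of Regev's iterative step (J. ACM 56 (2009), art. 34; author's version
arXiv:2401.03703, Lemma 3.14 and its proof) holds a point `x` of the fine lattice region in a register,
"computes `x mod P(L*)` in a second register", calls the `CVP_{L*,d}` oracle on it to "recover `x`" and
"uncompute the first register", then Fourier-transforms the second register. In the tree's finite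
precision version (Regev, §2 p. 11, footnote on the fine grid) the first register holds a GRID point
`x = x̃/D`, `x̃ ∈ ℤⁿ`, `D = R·|det B|` (`B` the integer basis of `L = L(B)`, rows `bᵢ`; `R = 2^{ℓ_R}`),
which is split along the fine lattice `Λ = L*/R` (basis `eⱼ = b∨ⱼ/R`, `b∨` the dual basis,
`Regev2009.dualOverBasis`) into its fractional part `y(x) = ZSpan.fract e x` (the branch) and its lattice
part `x − y(x) = Σⱼ ⌊aⱼ⌋ eⱼ`, `a = e.repr x`. This file gives that split, the residues handed to the
oracle and the recomposition that erases `x`, as EXACT INTEGER ARITHMETIC on `x̃`, and proves the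
identities the register-level analysis (`RegevQuantumPartData`: `yOfB`, `sOfB`, the `coset`/`Good`
bookkeeping) consumes:

* `detA I = |det B|`, `Dg I R = R·|det B|`, `gridPt I R x̃ = x̃/D`;
* `aVec I x̃ = ⌊B x̃ / |det B|⌋` (entrywise floor division) — **`floor_repr_gridPt`**: these ARE the
  floors `⌊(e.repr x)ⱼ⌋` of the coordinates of `x` (`repr_gridPt`: `(e.repr x)ⱼ = (B x̃)ⱼ/|det B|`, from
  `repr_eq`: `(e.repr v)ⱼ = R⟪bⱼ, v⟫`);
* `latPart I x̃ = sign(det B)·adj(B)⌊a⌋` (`Matrix.cramer`) — **`cast_latPart`**: `latPart/D` IS the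
  lattice part `ZSpan.floor e x` (the column `j` of `adj B` is `det B · b∨ⱼ`, `adjugate_col_eq`);
* `ytil I x̃ = x̃ − latPart` — **`fract_gridPt`**: `ZSpan.fract e (x̃/D) = ytil/D`, and
  **`repr_gridPt_sub_fract`**: the `ℤ`-coordinates of `x − y(x) ∈ Λ` are `aVec`;
* `sNat I R x̃ = ⌊a⌋ mod R ∈ [0, R)` (the residues, `sNat_lt`), `mVec = ⌊a⌋ / R`, `sNat_add_mul_mVec`;
  **`floor_sub_reprPt_eq`**: `(x − y(x)) − Σⱼ (sⱼ/R) b∨ⱼ = Σⱼ mⱼ b∨ⱼ`, a point of `L*` with dual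
  coordinates `mVec` (so the oracle, asked the residue point `Σⱼ (sⱼ/R) b∨ⱼ`, answers `−mVec` whenever
  `x − y(x)` is the short vector of its coset — the sequel);
* `recover I R ỹ s c = ỹ + sign(det B)·adj(B)(s − R·c)` — **`recover_eq_of`**: `= x̃` as soon as
  `s − R·c = ⌊a⌋`, in particular for `c = −mVec` (`recover_ytil`): the erasure of the first register is
  exact.

Everything is proved; definitions have bodies; no named fact is introduced.

## References

* O. Regev, *On lattices, learning with errors, random linear codes, and cryptography*, J. ACM 56
  (2009), art. 34; author's version arXiv:2401.03703: Lemma 3.14 (proof), §2 p. 11 (finite precision)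
  [Regev2009].
* C. Peikert, *Public-key cryptosystems from the worst-case shortest vector problem*, STOC 2009,
  §2.1 (the dual basis `B^{-t}`) [Peikert2009].
* D. Micciancio, S. Goldwasser, *Complexity of Lattice Problems*, Kluwer 2002, Ch. 1 §1.1 (Cramer's
  rule, the dual lattice of an integer lattice lies in `ℤⁿ/det`) [MicciancioGoldwasser2002].
-/

noncomputable section

namespace Literature.Computability.Cryptography

namespace Regev2009

namespace SamplerArith

open Literature.Algebra.EuclideanLattices Literature.Algebra.EuclideanLattices.Regev2009 Peikert2009 Matrix
  Finset
open scoped InnerProductSpace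

variable (I : LatticeInstance) (R : ℕ)

/-! ### The integer maps -/

/-- `|det B|`. [folklore] -/
def detA : ℕ := I.basis.det.natAbs

/-- **The grid denominator** `D = R·|det B|`. [cite: Regev2009, §2 p. 11 (the fine grid)] -/
def Dg : ℕ := R * detA I

/-- **The floors of the coordinates**: `⌊(B x̃)ⱼ / |det B|⌋`. [cite: Regev2009, Lemma 3.14 (proof: "x mod P(L*)")] -/
def aVec (x : Fin I.n → ℤ) : Fin I.n → ℤ := fun j => (I.basis *ᵥ x) j / (detA I : ℤ)

/-- **The lattice part in grid units**: `sign(det B)·adj(B)⌊a⌋`. [cite: Regev2009, Lemma 3.14 (proof)] -/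
def latPart (x : Fin I.n → ℤ) : Fin I.n → ℤ := I.basis.det.sign • I.basis.cramer (aVec I x)

/-- **The fractional part (the branch) in grid units**: `ỹ = x̃ − latPart`. [cite: Regev2009, Lemma 3.14 (proof)] -/
def ytil (x : Fin I.n → ℤ) : Fin I.n → ℤ := x - latPart I x

/-- **The residues** `sⱼ = ⌊aⱼ⌋ mod R ∈ [0, R)`, the content of the second register.
[cite: Regev2009, Lemma 3.14 (proof: "the natural mapping between L*/R ∩ P(L*) and ℤ_Rⁿ")] -/
def sNat (x : Fin I.n → ℤ) : Fin I.n → ℕ := fun j => (aVec I x j % (R : ℤ)).toNat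

/-- The quotients `mⱼ = ⌊aⱼ⌋ / R` (floor division). [folklore] -/
def mVec (x : Fin I.n → ℤ) : Fin I.n → ℤ := fun j => aVec I x j / (R : ℤ)

/-- **The recomposition that erases the first register**: `ỹ + sign(det B)·adj(B)(s − R·c)` from the
branch `ỹ`, the residues `s` and the oracle's answer `c`. [cite: Regev2009, Lemma 3.14 (proof: "using the CVP oracle, we can recover x")] -/
def recover (y : Fin I.n → ℤ) (s : Fin I.n → ℕ) (c : Fin I.n → ℤ) : Fin I.n → ℤ :=
  y + I.basis.det.sign • I.basis.cramer (fun j => (s j : ℤ) - R * c j)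

/-- **The grid point** `x̃/D ∈ D⁻¹ℤⁿ`. [cite: Regev2009, §2 p. 11] -/
def gridPt (x : Fin I.n → ℤ) : EuclideanSpace ℝ (Fin I.n) := ((Dg I R : ℝ)⁻¹) • intVecToEuclidean I.n x

/-! ### Integer identities -/

variable {I R}

/-- The residues are in range. [folklore] -/
theorem sNat_lt (hR : 0 < R) (x : Fin I.n → ℤ) (j : Fin I.n) : sNat I R x j < R := by
  have h0 : (0 : ℤ) ≤ aVec I x j % (R : ℤ) := Int.emod_nonneg _ (by exact_mod_cast hR.ne')
  have h1 : aVec I x j % (R : ℤ) < R := Int.emod_lt_of_pos _ (by exact_mod_cast hR)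
  unfold sNat
  omega

/-- `⌊a⌋ = s + R·m`. [folklore] -/
theorem sNat_add_mul_mVec (hR : 0 < R) (x : Fin I.n → ℤ) (j : Fin I.n) :
    (sNat I R x j : ℤ) + R * mVec I R x j = aVec I x j := by
  have h0 : (0 : ℤ) ≤ aVec I x j % (R : ℤ) := Int.emod_nonneg _ (by exact_mod_cast hR.ne')
  unfold sNat mVec
  rw [Int.toNat_of_nonneg h0]
  exact Int.emod_add_mul_ediv _ _

/-- **The erasure is exact** as soon as `s − R·c = ⌊a⌋`. [cite: Regev2009, Lemma 3.14 (proof)] -/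
theorem recover_eq_of (x : Fin I.n → ℤ) {s : Fin I.n → ℕ} {c : Fin I.n → ℤ}
    (h : ∀ j, (s j : ℤ) - R * c j = aVec I x j) : recover I R (ytil I x) s c = x := by
  have hfun : (fun j => (s j : ℤ) - R * c j) = aVec I x := funext h
  unfold recover ytil latPart
  rw [hfun]
  abel

/-- In particular with the residues and `c = −m`. [folklore] -/
theorem recover_ytil (hR : 0 < R) (x : Fin I.n → ℤ) : recover I R (ytil I x) (sNat I R x) (-mVec I R x) = x :=
  recover_eq_of x fun j => by rw [Pi.neg_apply, mul_neg, sub_neg_eq_add]; exact sNat_add_mul_mVec hR x j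

/-! ### The basis `eⱼ = b∨ⱼ/R` of `Λ = L*/R` and the coordinates of a vector -/

section Lattice

variable (I R)
variable [hZ : IsZLattice ℝ I.lattice] [NeZero R]

/-- **The basis `eⱼ = b∨ⱼ/R`** of `Λ = L(B)*/R` attached to the rows of `B`. [cite: Regev2009, Lemma 3.14 ("L*/R")] -/
abbrev eB : Module.Basis (Fin I.n) ℝ (EuclideanSpace ℝ (Fin I.n)) := dualOverBasis R I.lattice (zBasis I)

/-- `eⱼ = R⁻¹ b∨ⱼ`. [folklore] -/
theorem eB_apply (j : Fin I.n) : eB I R j = (R : ℝ)⁻¹ • dualVec I j := by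
  rw [eB, dualOverBasis_apply, ofZLatticeBasis_zBasis]
  rfl

omit hZ [NeZero R] in
/-- `⟪bᵢ, v⟫ = Σₖ Bᵢₖ vₖ = (B v)ᵢ`. [folklore] -/
theorem inner_vec (i : Fin I.n) (v : EuclideanSpace ℝ (Fin I.n)) : ⟪I.vec i, v⟫_ℝ = ∑ k, (I.basis i k : ℝ) * v k := by
  rw [EuclideanSpace.inner_eq_star_dotProduct, dotProduct]
  refine sum_congr rfl fun k _ => ?_
  simp [LatticeInstance.vec_apply, mul_comm]

omit [NeZero R] in
/-- **Biorthogonality** `⟪bᵢ, b∨ⱼ⟫ = δᵢⱼ`. [cite: Peikert2009, §2.1] -/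
theorem inner_vec_dualVec (i j : Fin I.n) : ⟪I.vec i, dualVec I j⟫_ℝ = if i = j then 1 else 0 := by
  rw [← coe_zBasis, ← coe_dualZBasis]
  exact inner_zBasis_dualZBasis I i j

/-- **The coordinates of a vector**: `(e.repr v)ⱼ = R⟪bⱼ, v⟫`. [folklore] -/
theorem repr_eq (v : EuclideanSpace ℝ (Fin I.n)) (j : Fin I.n) : (eB I R).repr v j = R * ⟪I.vec j, v⟫_ℝ := by
  have hR : (R : ℝ) ≠ 0 := by exact_mod_cast NeZero.ne R
  have hsum : v = ∑ i, (eB I R).repr v i • eB I R i := ((eB I R).sum_repr v).symm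
  have hinner : ⟪I.vec j, v⟫_ℝ = (R : ℝ)⁻¹ * (eB I R).repr v j := by
    conv_lhs => rw [hsum]
    rw [inner_sum]
    simp_rw [inner_smul_right, eB_apply, inner_smul_right, inner_vec_dualVec]
    rw [sum_eq_single j (fun i _ hij => by rw [if_neg (Ne.symm hij)]; ring) (fun h => absurd (mem_univ j) h)]
    rw [if_pos rfl]; ring
  rw [hinner]; field_simp

omit hZ [NeZero R] in
/-- `⟪bᵢ, x̃/D⟫ = (B x̃)ᵢ / D`. [folklore] -/
theorem inner_vec_gridPt (i : Fin I.n) (x : Fin I.n → ℤ) :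
    ⟪I.vec i, gridPt I R x⟫_ℝ = (Dg I R : ℝ)⁻¹ * ((I.basis *ᵥ x) i : ℤ) := by
  rw [gridPt, inner_smul_right, inner_vec]
  congr 1
  rw [mulVec, dotProduct]
  push_cast
  refine sum_congr rfl fun k _ => ?_
  rw [intVecToEuclidean_apply]

variable {I R}

/-- `|det B| ≠ 0`. [folklore] -/
theorem detA_ne_zero : detA I ≠ 0 := by
  have h : I.basis.det ≠ 0 := isNonsingular_of_isZLattice I
  unfold detA
  exact Int.natAbs_ne_zero.2 h

variable (I R)

/-- **The coordinates of a grid point**: `(e.repr (x̃/D))ⱼ = (B x̃)ⱼ / |det B|`. [cite: Regev2009, Lemma 3.14 (proof)] -/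
theorem repr_gridPt (x : Fin I.n → ℤ) (j : Fin I.n) :
    (eB I R).repr (gridPt I R x) j = ((I.basis *ᵥ x) j : ℤ) / (detA I : ℝ) := by
  have hR : (R : ℝ) ≠ 0 := by exact_mod_cast NeZero.ne R
  have hd : (detA I : ℝ) ≠ 0 := by exact_mod_cast detA_ne_zero
  rw [repr_eq, inner_vec_gridPt, Dg]
  push_cast
  field_simp

/-- **The floors of the coordinates are `aVec`.** [cite: Regev2009, Lemma 3.14 (proof)] -/
theorem floor_repr_gridPt (x : Fin I.n → ℤ) (j : Fin I.n) : ⌊(eB I R).repr (gridPt I R x) j⌋ = aVec I x j := by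
  rw [repr_gridPt, Int.floor_div_natCast, Int.floor_intCast]
  rfl

/-- `ZSpan.floor e (x̃/D) = Σⱼ (aVec)ⱼ eⱼ`. [folklore] -/
theorem coe_floor_gridPt (x : Fin I.n → ℤ) :
    (ZSpan.floor (eB I R) (gridPt I R x) : EuclideanSpace ℝ (Fin I.n)) = ∑ j, (aVec I x j : ℝ) • eB I R j := by
  refine (eB I R).ext_elem fun j => ?_
  rw [ZSpan.repr_floor_apply, floor_repr_gridPt, (eB I R).repr_sum_self]

/-- **The column `j` of `adj B` is `det B · b∨ⱼ`.** [cite: MicciancioGoldwasser2002, Ch. 1 §1.1 (Cramer)] -/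
theorem adjugate_col_eq (j : Fin I.n) :
    (WithLp.toLp 2 fun i => ((I.basis.adjugate i j : ℤ) : ℝ) : EuclideanSpace ℝ (Fin I.n)) = (I.basis.det : ℝ) • dualVec I j := by
  -- both sides have the same image under `v ↦ (⟪bᵢ, v⟫)ᵢ = B v`, and `B` is injective
  set B : Matrix (Fin I.n) (Fin I.n) ℝ := I.basis.map (Int.cast : ℤ → ℝ) with hB
  have hdet : B.det ≠ 0 := by
    have h0 : I.basis.det ≠ 0 := isNonsingular_of_isZLattice I
    rw [hB, show I.basis.map (Int.cast : ℤ → ℝ) = (Int.castRingHom ℝ).mapMatrix I.basis from rfl, ← RingHom.map_det,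
      eq_intCast]
    exact_mod_cast h0
  have hinj : Function.Injective B.mulVec :=
    Matrix.mulVec_injective_iff_isUnit.2 ((Matrix.isUnit_iff_isUnit_det _).2 (Ne.isUnit hdet))
  have key : ∀ v : EuclideanSpace ℝ (Fin I.n), B *ᵥ (v : Fin I.n → ℝ) = fun i => ⟪I.vec i, v⟫_ℝ := by
    intro v; funext i
    rw [inner_vec, mulVec, dotProduct]
    refine sum_congr rfl fun k _ => ?_
    rw [hB, map_apply]
  -- image of the left side: column `j` of `B · adj B = det • 1`
  have hL : B *ᵥ (fun i => ((I.basis.adjugate i j : ℤ) : ℝ)) = fun i => if i = j then (I.basis.det : ℝ) else 0 := by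
    funext i
    have hi : (∑ k, I.basis i k * I.basis.adjugate k j) = if i = j then I.basis.det else 0 := by
      have := congrFun (congrFun I.basis.mul_adjugate i) j
      rw [Matrix.mul_apply, Matrix.smul_apply, Matrix.one_apply, smul_eq_mul, mul_ite, mul_one, mul_zero] at this
      exact this
    rw [mulVec, dotProduct]
    simp only [hB, map_apply]
    exact_mod_cast hi
  have hRgt : B *ᵥ ((((I.basis.det : ℝ) • dualVec I j : EuclideanSpace ℝ (Fin I.n)) : Fin I.n → ℝ)) =
      fun i => if i = j then (I.basis.det : ℝ) else 0 := by
    rw [key]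
    funext i
    rw [inner_smul_right, inner_vec_dualVec]
    split_ifs <;> simp
  have h := hinj (hL.trans hRgt.symm)
  -- `h : (adj column as a function) = ofLp (det • b∨ⱼ)`
  rw [show (WithLp.toLp 2 fun i => ((I.basis.adjugate i j : ℤ) : ℝ) : EuclideanSpace ℝ (Fin I.n)) =
      WithLp.toLp 2 (WithLp.ofLp ((I.basis.det : ℝ) • dualVec I j)) from congrArg (WithLp.toLp 2) h]

omit hZ [NeZero R] in
/-- `sign(det B) · det B = |det B|`. [folklore] -/
theorem sign_mul_det : ((I.basis.det.sign : ℤ) : ℝ) * (I.basis.det : ℝ) = (detA I : ℝ) := by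
  unfold detA
  rw [← Int.cast_mul, Int.sign_mul_self, Int.cast_natCast]

/-- **The lattice part in grid units IS the `ZSpan` floor**: `latPart/D = ZSpan.floor e (x̃/D)`.
[cite: Regev2009, Lemma 3.14 (proof: "x mod P(L*)")] -/
theorem cast_latPart (x : Fin I.n → ℤ) :
    intVecToEuclidean I.n (latPart I x) = (Dg I R : ℝ) • (ZSpan.floor (eB I R) (gridPt I R x) : EuclideanSpace ℝ (Fin I.n)) := by
  have hR : (R : ℝ) ≠ 0 := by exact_mod_cast NeZero.ne R
  rw [coe_floor_gridPt, smul_sum]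
  -- right side: `D · aⱼ · R⁻¹ · b∨ⱼ = |det B| aⱼ b∨ⱼ`
  have hr : ∀ j, (Dg I R : ℝ) • ((aVec I x j : ℝ) • eB I R j) = ((detA I : ℝ) * (aVec I x j : ℝ)) • dualVec I j := by
    intro j
    rw [eB_apply, smul_smul, smul_smul, Dg]
    push_cast
    congr 1
    field_simp
  simp_rw [hr]
  -- left side: `sign · Σⱼ aⱼ (adj B)_{·j}`
  have hl : intVecToEuclidean I.n (latPart I x) =
      ∑ j, (((I.basis.det.sign : ℤ) : ℝ) * (aVec I x j : ℝ)) • (WithLp.toLp 2 fun i => ((I.basis.adjugate i j : ℤ) : ℝ) : EuclideanSpace ℝ (Fin I.n)) := by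
    ext i
    rw [intVecToEuclidean_apply, latPart, cramer_eq_adjugate_mulVec]
    simp only [Pi.smul_apply, smul_eq_mul, mulVec, dotProduct, WithLp.ofLp_sum, WithLp.ofLp_smul, Finset.sum_apply]
    push_cast
    rw [mul_sum]
    refine sum_congr rfl fun j _ => ?_
    ring
  rw [hl]
  refine sum_congr rfl fun j _ => ?_
  rw [adjugate_col_eq, smul_smul]
  congr 1
  rw [mul_right_comm, sign_mul_det]

/-- **The fractional part of a grid point**: `ZSpan.fract e (x̃/D) = ỹ/D`. [cite: Regev2009, Lemma 3.14 (proof)] -/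
theorem fract_gridPt (x : Fin I.n → ℤ) : ZSpan.fract (eB I R) (gridPt I R x) = gridPt I R (ytil I x) := by
  have hD : (Dg I R : ℝ) ≠ 0 := by
    have := detA_ne_zero (I := I); have := NeZero.ne R; unfold Dg; exact_mod_cast Nat.mul_ne_zero ‹_› ‹_›
  rw [ZSpan.fract_apply, gridPt, gridPt, ytil, map_sub, smul_sub, cast_latPart I R x, smul_smul, inv_mul_cancel₀ hD, one_smul]
  rfl

/-- `x − y(x) = latPart/D`. [folklore] -/
theorem gridPt_sub_fract (x : Fin I.n → ℤ) :
    gridPt I R x - ZSpan.fract (eB I R) (gridPt I R x) = (ZSpan.floor (eB I R) (gridPt I R x) : EuclideanSpace ℝ (Fin I.n)) := by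
  rw [ZSpan.fract_apply]; abel

/-- `x − y(x) ∈ Λ = L*/R`. [folklore] -/
theorem gridPt_sub_fract_mem (x : Fin I.n → ℤ) :
    gridPt I R x - ZSpan.fract (eB I R) (gridPt I R x) ∈ dualOver R I.lattice (zBasis I) := by
  rw [gridPt_sub_fract]
  exact (ZSpan.floor (eB I R) (gridPt I R x)).2

/-- **The `ℤ`-coordinates of the lattice part are `aVec`.** [cite: Regev2009, Lemma 3.14 (proof)] -/
theorem repr_gridPt_sub_fract (x : Fin I.n → ℤ) (h : gridPt I R x - ZSpan.fract (eB I R) (gridPt I R x) ∈ dualOver R I.lattice (zBasis I))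
    (j : Fin I.n) : (dualOverZBasis R I.lattice (zBasis I)).repr ⟨_, h⟩ j = aVec I x j := by
  have hval : (⟨_, h⟩ : dualOver R I.lattice (zBasis I)) = ZSpan.floor (eB I R) (gridPt I R x) := Subtype.ext (gridPt_sub_fract I R x)
  rw [hval]
  apply Int.cast_injective (α := ℝ)
  have h1 : (((dualOverZBasis R I.lattice (zBasis I)).repr (ZSpan.floor (eB I R) (gridPt I R x)) j : ℤ) : ℝ) =
      (eB I R).repr (ZSpan.floor (eB I R) (gridPt I R x) : EuclideanSpace ℝ (Fin I.n)) j := by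
    rw [dualOverZBasis]
    exact (Module.Basis.restrictScalars_repr_apply ℤ (eB I R) _ j)
  rw [h1, ZSpan.repr_floor_apply, floor_repr_gridPt]

/-- **The residue point and the lattice part differ by a point of `L*`**:
`(x − y(x)) − Σⱼ (sⱼ/R) b∨ⱼ = Σⱼ mⱼ b∨ⱼ`. [cite: Regev2009, Lemma 3.14 (proof: "using the CVP oracle, we can recover x")] -/
theorem floor_sub_reprPt_eq (x : Fin I.n → ℤ) :
    (ZSpan.floor (eB I R) (gridPt I R x) : EuclideanSpace ℝ (Fin I.n)) - ∑ j, ((sNat I R x j : ℝ) / (R : ℝ)) • dualVec I j =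
      ∑ j, (mVec I R x j : ℝ) • dualVec I j := by
  have hR : (R : ℝ) ≠ 0 := by exact_mod_cast NeZero.ne R
  have hR0 : 0 < R := Nat.pos_of_ne_zero (NeZero.ne R)
  rw [coe_floor_gridPt, sub_eq_iff_eq_add, ← sum_add_distrib]
  refine sum_congr rfl fun j _ => ?_
  rw [eB_apply, smul_smul, div_eq_mul_inv, ← add_smul]
  congr 1
  have h := sNat_add_mul_mVec hR0 x j
  have h' : (aVec I x j : ℝ) = (sNat I R x j : ℝ) + (R : ℝ) * (mVec I R x j : ℝ) := by exact_mod_cast h.symm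
  rw [h']; field_simp; ring

omit [NeZero R] in
/-- The same point of `L*` as an element of the dual lattice with dual coordinates `mVec`. [folklore] -/
theorem sum_mVec_smul_mem (x : Fin I.n → ℤ) : ∑ j, (mVec I R x j : ℝ) • dualVec I j ∈ dualLattice I.lattice := by
  refine Submodule.sum_mem _ fun j _ => ?_
  rw [← coe_dualZBasis, Int.cast_smul_eq_zsmul]
  exact Submodule.smul_mem _ _ (dualZBasis I j).2

omit [NeZero R] in
/-- Its dual coordinates. [folklore] -/
theorem repr_sum_mVec (x : Fin I.n → ℤ) (j : Fin I.n) :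
    (dualZBasis I).repr ⟨_, sum_mVec_smul_mem I R x⟩ j = mVec I R x j := by
  have h : (⟨_, sum_mVec_smul_mem I R x⟩ : dualLattice I.lattice) = ∑ i, mVec I R x i • dualZBasis I i := by
    apply Subtype.ext
    show (∑ i, (mVec I R x i : ℝ) • dualVec I i) = ((∑ i, mVec I R x i • dualZBasis I i : dualLattice I.lattice) : EuclideanSpace ℝ (Fin I.n))
    simp only [AddSubmonoidClass.coe_finsetSum, Submodule.coe_smul_of_tower, coe_dualZBasis, Int.cast_smul_eq_zsmul]
  rw [h, (dualZBasis I).repr_sum_self]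

end Lattice

end SamplerArith

end Regev2009

end Literature.Computability.Cryptography

end
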